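import Literature.AnabelianGeometry.SemiGraphs.TemperedAnabelianThm64SubCoveringDatum
import Mathlib.FieldTheory.KummerPolynomial
import HarnessLib

/-!
# [SemiAnbd] Thm. 6.4 sub-DAG, F-2831 / F-2832 at covering data: a KERNEL WITNESS that the covering class of
# `TemperedAnabelianThm64SubCoveringDatum.lean` (p489170) contains a NON-identity member for EVERY `Y`

S. Mochizuki, *Semi-graphs of anabelioids*, Publ. RIMS **42** (2006) [SemiAnbd], §6 p. 69 l. 40–48 (`K` a finite
extension of `ℚ_p`, `G_K ⊆ G_{ℚ_p}`, the exact sequence `1 → Δ^temp_X → Π^temp_{X_K} → G_K → 1`) and Thm. 6.4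
pp. 70–71 («an open immersion which arises from an embedding of fields `L ↪ K`»).
[cite: MochizukiSemiAnbd2006, Thm 6.4 pp.70-71]

PROOF-ONLY companion (no definition, no instance, no new named fact) of abc-iut-f-168's
`TemperedAnabelianThm64SubCoveringDatum.lean`, written by the RQ7 second reader of that file (abc-iut-w6-d085 gen 4,
AUDIT LOW 1: «instance class ⊋ identity» was a statement about the parameter space, no proper member was exhibited).
Here the proper member is exhibited, hypothesis-free, for every `Y : TemperedCurve p`:

* the **constant-field coverings** `Y_{K'} → Y_L`: for a finite extension `K' ⊇ L` inside `K̄`, the aug-SATURATED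
  subgroup `H_{K'} := aug⁻¹(G_{K'}) ≤ Π^temp_{Y_L}` is OPEN (`isOpen_comap_aug_fixingSubgroup`), of FINITE INDEX
  `[G_L : G_{K'}]` (`finiteIndex_comap_aug_fixingSubgroup`), has `aug(H_{K'}) = G_{K'}`
  (`range_aug_comp_subtype_comap_aug_fixingSubgroup`), and — because it is saturated — its decomposition groups
  surject onto OPEN subgroups: `aug(H_{K'} ∩ g D_y g⁻¹) = G_{K'} ∩ aug(g)·aug(D_y)·aug(g)⁻¹`
  (`isOpen_image_aug_decompOfOpenAt_comap_aug_fixingSubgroup`), so ALL side conditions of abc-iut-L6-t7's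
  `TemperedCurve.ofOpenSubgroup` hold with NO hypothesis; and `H_{K'} ≠ ⊤` as soon as `K' ≠ L`
  (`comap_aug_fixingSubgroup_ne_top`, infinite Galois correspondence);
* `exists_finiteDimensional_lt` — every finite extension `L` of `ℚ_p` inside `K̄` has a PROPER finite extension
  `K' ⊋ L` inside `K̄` (a root of `X^q − p`, `q` a prime exceeding `[L : ℚ_p]`: `X^q − p` is irreducible over `ℚ_p`
  because `p` is not a `q`-th power in `ℚ_p` — valuations — so the root has degree `q > [L : ℚ_p]` over `ℚ_p`);
* `geometricIsGaloisCompatible_constantField` — F-2832 FIRES, with no leaf, at the covering map `Y_{K'} → Y_L`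
  itself; `exists_proper_coveringDatum` — for EVERY `Y : TemperedCurve p` there is a proper open finite-index
  `H ≠ ⊤` with all side data at which p489170's `geometricIsGaloisCompatible_inclusion` holds: the covering class
  is inhabited beyond the identity datum at every `Y`, in the kernel.

Classical (Krull topology, Galois correspondence, Kummer polynomials over `ℚ_p`); nothing here bears on the disputed
[IUTchIII] Cor. 3.12; instance ≠ the printed universal statement; typed ≠ proved for print's Thm. 6.4 itself.
-/

noncomputable section

namespace Literature.AnabelianGeometry.SemiGraphs

namespace TemperedCurve

open _root_.Topology _root_.Polynomial

variable {p : ℕ} [Fact p.Prime] (Y : TemperedCurve p)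
  (K' : IntermediateField ℚ_[p] (AlgebraicClosure ℚ_[p])) [FiniteDimensional ℚ_[p] K']

/-! ### The saturated subgroup `H_{K'} = aug⁻¹(G_{K'})` of a constant-field extension -/

/-- `H_{K'} = aug⁻¹(G_{K'})` is open in `Π^temp_{Y_L}` (`G_{K'}` is open for `K'/ℚ_p` finite, Krull topology).
[cite: MochizukiSemiAnbd2006, §6 p.69] -/
theorem isOpen_comap_aug_fixingSubgroup :
    IsOpen (((K'.fixingSubgroup).comap Y.aug.toMonoidHom : Subgroup Y.PiTemp) : Set Y.PiTemp) := by
  rw [Subgroup.coe_comap]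
  exact K'.fixingSubgroup_isOpen.preimage (map_continuous Y.aug)

/-- `H_{K'}` has finite index in `Π^temp_{Y_L}`, namely `[G_L : G_{K'}]`, when `L ≤ K'`.
[cite: MochizukiSemiAnbd2006, §6 p.69] -/
theorem finiteIndex_comap_aug_fixingSubgroup (hLK : Y.K ≤ K') :
    ((K'.fixingSubgroup).comap Y.aug.toMonoidHom : Subgroup Y.PiTemp).FiniteIndex := by
  haveI : IsGalois ℚ_[p] (AlgebraicClosure ℚ_[p]) := {}
  haveI : Finite (GQp p ⧸ K'.fixingSubgroup) :=
    Subgroup.quotient_finite_of_isOpen _ K'.fixingSubgroup_isOpen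
  haveI hfi : (K'.fixingSubgroup : Subgroup (GQp p)).FiniteIndex := Subgroup.finiteIndex_of_finite_quotient
  refine ⟨fun h0 => ?_⟩
  rw [Subgroup.index_comap, Y.range_aug] at h0
  have hdvd := Subgroup.relIndex_dvd_index_of_le (IntermediateField.fixingSubgroup_le hLK)
  rw [h0] at hdvd
  exact hfi.index_ne_zero (Nat.eq_zero_of_zero_dvd hdvd)

omit [FiniteDimensional ℚ_[p] K'] in
/-- `aug(H_{K'}) = G_{K'}` when `L ≤ K'` (as `G_{K'} ≤ G_L = aug(Π^temp_{Y_L})`).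
[cite: MochizukiSemiAnbd2006, §6 p.69] -/
theorem range_aug_comp_subtype_comap_aug_fixingSubgroup (hLK : Y.K ≤ K') :
    (Y.aug.toMonoidHom.comp ((K'.fixingSubgroup).comap Y.aug.toMonoidHom).subtype).range =
      K'.fixingSubgroup := by
  ext σ
  constructor
  · rintro ⟨h, rfl⟩
    exact h.2
  · intro hσ
    have hσL : σ ∈ Y.aug.toMonoidHom.range := by
      rw [Y.range_aug]
      exact IntermediateField.fixingSubgroup_le hLK hσ
    obtain ⟨z, hz⟩ := hσL
    have hzH : z ∈ ((K'.fixingSubgroup).comap Y.aug.toMonoidHom : Subgroup Y.PiTemp) := by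
      rw [Subgroup.mem_comap, hz]
      exact hσ
    exact ⟨⟨z, hzH⟩, hz⟩

/-- **Saturation pays for `hDopen`.**  For the saturated `H_{K'}`, the image under `aug` of the decomposition
group `H_{K'} ∩ g D_y g⁻¹` is `G_{K'} ∩ aug(g)·aug(D_y)·aug(g)⁻¹`, an open subset of `G_{ℚ_p}` («`D_x` always
surjects onto an open subgroup of `G_K`», p. 71, for the covering). [cite: MochizukiSemiAnbd2006, §6 p.71] -/
theorem isOpen_image_aug_decompOfOpenAt_comap_aug_fixingSubgroup (y : Y.Pt) (g : Y.PiTemp) :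
    IsOpen (Y.aug '' ((Y.decompOfOpenAt ((K'.fixingSubgroup).comap Y.aug.toMonoidHom) y g).map
      ((K'.fixingSubgroup).comap Y.aug.toMonoidHom).subtype : Set Y.PiTemp)) := by
  have hset : Y.aug '' ((Y.decompOfOpenAt ((K'.fixingSubgroup).comap Y.aug.toMonoidHom) y g).map
      ((K'.fixingSubgroup).comap Y.aug.toMonoidHom).subtype : Set Y.PiTemp) =
      (K'.fixingSubgroup : Set (GQp p)) ∩
        (fun σ : GQp p => (Y.aug g)⁻¹ * σ * Y.aug g) ⁻¹' (Y.aug '' (Y.decomp y : Set Y.PiTemp)) := by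
    ext σ
    simp only [Set.mem_image, SetLike.mem_coe, Subgroup.mem_map, Set.mem_inter_iff, Set.mem_preimage]
    constructor
    · rintro ⟨z, ⟨h, hh, rfl⟩, rfl⟩
      refine ⟨h.2, g⁻¹ * (h : Y.PiTemp) * g⁻¹⁻¹, Y.mem_decompOfOpenAt _ |>.1 hh, ?_⟩
      simp only [map_mul, map_inv, inv_inv, Subgroup.coe_subtype]
    · rintro ⟨hσ, d, hd, hdσ⟩
      have hz : Y.aug (g * d * g⁻¹) = σ := by
        rw [map_mul, map_mul, map_inv, hdσ]
        group
      have hzH : g * d * g⁻¹ ∈ ((K'.fixingSubgroup).comap Y.aug.toMonoidHom : Subgroup Y.PiTemp) := by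
        rw [Subgroup.mem_comap]
        change Y.aug (g * d * g⁻¹) ∈ K'.fixingSubgroup
        rw [hz]
        exact hσ
      refine ⟨g * d * g⁻¹, ⟨⟨g * d * g⁻¹, hzH⟩, ?_, rfl⟩, hz⟩
      rw [Y.mem_decompOfOpenAt]
      have : g⁻¹ * (g * d * g⁻¹) * g⁻¹⁻¹ = d := by group
      rw [Subgroup.coe_mk, this]
      exact hd
  rw [hset]
  exact K'.fixingSubgroup_isOpen.inter ((Y.isOpen_aug_decomp y).preimage (by fun_prop))

omit [FiniteDimensional ℚ_[p] K'] in
/-- `H_{K'}` is a PROPER subgroup of `Π^temp_{Y_L}` as soon as `K' ≠ L` (given `L ≤ K'`): `H_{K'} = ⊤` would give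
`G_L = aug(Π^temp_{Y_L}) ≤ G_{K'}`, whence `K' ≤ L` by the Galois correspondence of `K̄/ℚ_p`.
[cite: MochizukiSemiAnbd2006, §6 p.69] -/
theorem comap_aug_fixingSubgroup_ne_top (hLK : Y.K ≤ K') (hne : Y.K ≠ K') :
    ((K'.fixingSubgroup).comap Y.aug.toMonoidHom : Subgroup Y.PiTemp) ≠ ⊤ := by
  haveI : IsGalois ℚ_[p] (AlgebraicClosure ℚ_[p]) := {}
  intro htop
  apply hne (le_antisymm hLK _)
  have hGL : Y.K.fixingSubgroup ≤ K'.fixingSubgroup := by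
    rw [← Y.range_aug]
    rintro _ ⟨z, rfl⟩
    have hz : z ∈ ((K'.fixingSubgroup).comap Y.aug.toMonoidHom : Subgroup Y.PiTemp) := htop ▸ Subgroup.mem_top z
    exact hz
  rw [← InfiniteGalois.fixedField_fixingSubgroup Y.K, IntermediateField.le_iff_le]
  exact hGL

/-! ### F-2832 / F-2831 FIRE at the constant-field covering `Y_{K'} → Y_L` -/

/-- **F-2832 at the constant-field covering `Y_{K'} → Y_L`, NO leaf, NO side hypothesis**: for every Thm-6.4 datum
`C` on `(Y_{K'}, Y_L)` in p489170's class `hC`, every `π₁^temp(f)` lies over `G_{K'} → G_L` from `L ↪ K'`.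
[cite: MochizukiSemiAnbd2006, Thm 6.4 pp.70-71] -/
theorem geometricIsGaloisCompatible_constantField (hLK : Y.K ≤ K') :
    letI := Y.finiteIndex_comap_aug_fixingSubgroup K' hLK
    ∀ (C : TemperedCurveHom p
        (Y.ofOpenSubgroup ((K'.fixingSubgroup).comap Y.aug.toMonoidHom) (Y.isOpen_comap_aug_fixingSubgroup K')
          K' (Y.range_aug_comp_subtype_comap_aug_fixingSubgroup K' hLK)
          (Y.isOpen_image_aug_decompOfOpenAt_comap_aug_fixingSubgroup K')) Y),
      (∀ f : C.DomHom, ∃ γ : Y.PiTemp, ∀ x : ((K'.fixingSubgroup).comap Y.aug.toMonoidHom : Subgroup Y.PiTemp),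
          C.pi1 f x = γ * (x : Y.PiTemp) * γ⁻¹) →
      GeometricIsGaloisCompatible C := by
  intro C hC
  letI := Y.finiteIndex_comap_aug_fixingSubgroup K' hLK
  exact Y.geometricIsGaloisCompatible_covering _ _ K' _ _ C hC

/-- **F-2832 at the covering map `Y_{K'} → Y_L` ITSELF** (the explicit datum `⟨Unit, fun _ => H_{K'} ↪ Π^temp_{Y_L}⟩`,
`g = 1`), no hypothesis beyond `L ≤ K'`. [cite: MochizukiSemiAnbd2006, Thm 6.4 pp.70-71] -/
theorem geometricIsGaloisCompatible_constantField_inclusion (hLK : Y.K ≤ K') :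
    letI := Y.finiteIndex_comap_aug_fixingSubgroup K' hLK
    GeometricIsGaloisCompatible
      (⟨Unit, fun _ => ContinuousMonoidHom.mk
          ((K'.fixingSubgroup).comap Y.aug.toMonoidHom : Subgroup Y.PiTemp).subtype continuous_subtype_val⟩ :
        TemperedCurveHom p
          (Y.ofOpenSubgroup ((K'.fixingSubgroup).comap Y.aug.toMonoidHom) (Y.isOpen_comap_aug_fixingSubgroup K')
            K' (Y.range_aug_comp_subtype_comap_aug_fixingSubgroup K' hLK)
            (Y.isOpen_image_aug_decompOfOpenAt_comap_aug_fixingSubgroup K')) Y) := by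
  letI := Y.finiteIndex_comap_aug_fixingSubgroup K' hLK
  exact Y.geometricIsGaloisCompatible_inclusion _ _ K' _ _

/-- **F-2831 at the constant-field covering from the virtually-free tower input on `Π^temp_{Y_L}`** (one leaf, as in
p489170). [cite: MochizukiSemiAnbd2006, Thm 6.4 proof p.71] -/
theorem geometricIsDFG_constantField_of_tower (hLK : Y.K ≤ K')
    (htower₀ : ∀ U ∈ 𝓝 (1 : Y.PiTemp), ∃ N : OpenNormalSubgroup Y.PiTemp, (N : Set Y.PiTemp) ⊆ U ∧
      ∃ (G : Subgroup (Y.PiTemp ⧸ N.toSubgroup)) (_ : IsFreeGroup G), G.Normal ∧ G.FiniteIndex ∧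
        Finite (IsFreeGroup.Generators G) ∧ ∃ a ∈ G, ∃ b ∈ G, a * b ≠ b * a) :
    letI := Y.finiteIndex_comap_aug_fixingSubgroup K' hLK
    ∀ (C : TemperedCurveHom p
        (Y.ofOpenSubgroup ((K'.fixingSubgroup).comap Y.aug.toMonoidHom) (Y.isOpen_comap_aug_fixingSubgroup K')
          K' (Y.range_aug_comp_subtype_comap_aug_fixingSubgroup K' hLK)
          (Y.isOpen_image_aug_decompOfOpenAt_comap_aug_fixingSubgroup K')) Y),
      (∀ f : C.DomHom, ∃ γ : Y.PiTemp, ∀ x : ((K'.fixingSubgroup).comap Y.aug.toMonoidHom : Subgroup Y.PiTemp),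
          C.pi1 f x = γ * (x : Y.PiTemp) * γ⁻¹) →
      GeometricIsDFG C := by
  intro C hC
  letI := Y.finiteIndex_comap_aug_fixingSubgroup K' hLK
  exact Y.geometricIsDFG_covering_of_tower _ _ K' _ _ htower₀ C hC

/-! ### Every finite extension of `ℚ_p` inside `K̄` has a proper finite extension inside `K̄` -/

/-- `p` is not a `q`-th power in `ℚ_p` for `2 ≤ q` (valuations: `q · v(b) = v(p) = 1`). [folklore] -/
private theorem pow_ne_p {q : ℕ} (hq : 2 ≤ q) (b : ℚ_[p]) : b ^ q ≠ (p : ℚ_[p]) := by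
  intro h
  have hb : b ≠ 0 := by
    rintro rfl
    rw [zero_pow (by omega)] at h
    exact (NeZero.ne (p : ℚ_[p])) h.symm
  have hv := Padic.valuation_pow b q
  rw [h, Padic.valuation_p] at hv
  have hdvd : (q : ℤ) ∣ 1 := ⟨b.valuation, hv⟩
  have hq1 : (q : ℤ) ≤ 1 := Int.le_of_dvd one_pos hdvd
  omega

/-- **The Eisenstein polynomial `X^q − p` is irreducible over `ℚ_p`** (Serre, *Local Fields*, Ch. I §6 Prop. 17:
an Eisenstein polynomial `X^n + a₁X^{n−1} + ⋯ + a_n`, `a_i ∈ 𝔪`, `a_n ∉ 𝔪²`, defines a discrete valuation ring, so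
is irreducible; here for prime `q`, proved through Mathlib's Kummer criterion — `p` is not a `q`-th power in `ℚ_p`).
[cite: SerreLocalFields1979, Ch. I §6 Prop. 17] -/
theorem irreducible_X_pow_sub_C_p {q : ℕ} (hq : q.Prime) : Irreducible (X ^ q - C (p : ℚ_[p])) :=
  X_pow_sub_C_irreducible_of_prime hq fun b => pow_ne_p (p := p) hq.two_le b

/-- **`ℚ_p` has (totally ramified) extensions of every degree** — roots of the Eisenstein polynomials `X^n − p`
(Serre, *Local Fields*, Ch. I §6 Prop. 17) — **so every finite extension `L` of `ℚ_p` inside `K̄` has a PROPER finite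
extension inside `K̄`**: adjoin a root `α` of `X^q − p` with `q` a prime `> [L : ℚ_p]`; `α ∉ L` since its degree over
`ℚ_p` is `q`. [cite: SerreLocalFields1979, Ch. I §6 Prop. 17] -/
theorem exists_finiteDimensional_lt (L : IntermediateField ℚ_[p] (AlgebraicClosure ℚ_[p]))
    [FiniteDimensional ℚ_[p] L] :
    ∃ K' : IntermediateField ℚ_[p] (AlgebraicClosure ℚ_[p]), FiniteDimensional ℚ_[p] K' ∧ L < K' := by
  obtain ⟨q, hqd, hq⟩ := Nat.exists_infinite_primes (Module.finrank ℚ_[p] L + 1)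
  have hirr := irreducible_X_pow_sub_C_p (p := p) hq
  have hdeg : (X ^ q - C (p : ℚ_[p])).natDegree = q := natDegree_X_pow_sub_C
  have hmonic : (X ^ q - C (p : ℚ_[p])).Monic := monic_X_pow_sub_C (p : ℚ_[p]) hq.ne_zero
  -- a root `α ∈ K̄`
  obtain ⟨α, hα⟩ := IsAlgClosed.exists_aeval_eq_zero (AlgebraicClosure ℚ_[p]) (X ^ q - C (p : ℚ_[p]))
    (by rw [degree_X_pow_sub_C hq.pos]; exact_mod_cast hq.ne_zero)
  have hmin : minpoly ℚ_[p] α = X ^ q - C (p : ℚ_[p]) := (minpoly.eq_of_irreducible_of_monic hirr hα hmonic).symm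
  have hint : IsIntegral ℚ_[p] α := ⟨_, hmonic, by simpa [Polynomial.eval₂_eq_eval_map, aeval_def] using hα⟩
  refine ⟨L ⊔ IntermediateField.adjoin ℚ_[p] {α}, ?_, ?_⟩
  · haveI : FiniteDimensional ℚ_[p] (IntermediateField.adjoin ℚ_[p] {α}) :=
      IntermediateField.adjoin.finiteDimensional hint
    exact IntermediateField.finiteDimensional_sup L _
  · refine lt_of_le_of_ne le_sup_left fun hEq => ?_
    have hαL : α ∈ L := by
      rw [hEq]
      exact IntermediateField.subset_adjoin ℚ_[p] {α} |> fun h => (le_sup_right : _ ≤ L ⊔ _) (h rfl)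
    -- degree of `α` over `ℚ_p` is `q`, but elements of `L` have degree `≤ [L : ℚ_p] < q`
    have hle : (minpoly ℚ_[p] (⟨α, hαL⟩ : L)).natDegree ≤ Module.finrank ℚ_[p] L := minpoly.natDegree_le _
    have heq : minpoly ℚ_[p] (⟨α, hαL⟩ : L) = minpoly ℚ_[p] α :=
      minpoly.algebraMap_eq (algebraMap L (AlgebraicClosure ℚ_[p])).injective ⟨α, hαL⟩ |>.symm
    rw [heq, hmin, hdeg] at hle
    omega

/-! ### The headline: a PROPER covering datum exists for every `Y`, and F-2832 holds there -/

/-- **For EVERY `Y : TemperedCurve p` the covering class of p489170 has a NON-identity member, with all side data and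
no hypothesis, at which F-2832 holds for the covering map itself**: a proper open subgroup `H ≠ ⊤` of finite index
of `Π^temp_{Y_L}` (the constant-field covering `Y_{K'} → Y_L` for a proper finite `K' ⊋ L`), `aug(H) = G_{K'}`,
decomposition images open, and `GeometricIsGaloisCompatible ⟨Unit, fun _ => H ↪ Π^temp_{Y_L}⟩`.
[cite: MochizukiSemiAnbd2006, Thm 6.4 pp.70-71] -/
theorem exists_proper_coveringDatum :
    ∃ (K' : IntermediateField ℚ_[p] (AlgebraicClosure ℚ_[p])) (_ : FiniteDimensional ℚ_[p] K')
      (H : Subgroup Y.PiTemp) (hHo : IsOpen (H : Set Y.PiTemp)) (hfi : H.FiniteIndex)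
      (hK' : (Y.aug.toMonoidHom.comp H.subtype).range = K'.fixingSubgroup)
      (hDopen : ∀ (y : Y.Pt) (g : Y.PiTemp),
        IsOpen (Y.aug '' ((Y.decompOfOpenAt H y g).map H.subtype : Set Y.PiTemp))),
      Y.K < K' ∧ H ≠ ⊤ ∧
        GeometricIsGaloisCompatible
          (⟨Unit, fun _ => ContinuousMonoidHom.mk H.subtype continuous_subtype_val⟩ :
            TemperedCurveHom p (@ofOpenSubgroup p _ Y H hHo hfi K' _ hK' hDopen) Y) := by
  haveI := Y.finiteDimensional_K
  obtain ⟨K', hfd, hlt⟩ := exists_finiteDimensional_lt (p := p) Y.K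
  haveI := hfd
  exact ⟨K', hfd, _, Y.isOpen_comap_aug_fixingSubgroup K', Y.finiteIndex_comap_aug_fixingSubgroup K' hlt.le,
    Y.range_aug_comp_subtype_comap_aug_fixingSubgroup K' hlt.le,
    Y.isOpen_image_aug_decompOfOpenAt_comap_aug_fixingSubgroup K', hlt,
    Y.comap_aug_fixingSubgroup_ne_top K' hlt.le hlt.ne,
    Y.geometricIsGaloisCompatible_constantField_inclusion K' hlt.le⟩

end TemperedCurve

end Literature.AnabelianGeometry.SemiGraphs

end
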